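import Mathlib

/-!
# Route PhotonSphereChannels · BlindnessInsidePhotonSphere — the 1+1 wave equation with a
# potential, III: from null coordinates back to `(t, x)`, and time symmetrisation

Support file (pure analysis, everything proved) for item stmt-FinalStateConjecture-10049.
Abstract input: `U ∈ C²(ℝ²)` with `DU = P da + Q db`, `P, Q ∈ C¹`, `∂_b P = ∂_a Q = c U`
(the output of the bootstrap of `PhotonSphereChannelsBlindnessWaveRegularity`). Output:

* `ψ(t, x) = U(x + t, x − t)` is `C²`, its time and space lines have the derivatives
  `P − Q`, `P + Q` (composed with `(t, x) ↦ (x + t, x − t)`), and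
  `ψ_tt − ψ_xx = −4 c ψ` in the `iteratedDeriv` form used by the route statement
  (`iteratedDeriv_two_time_sub_space`) — the chain rule `∂_t = ∂_a − ∂_b`, `∂_x = ∂_a + ∂_b`;
* the class of such quadruples `(U, P, Q, c)` with `c` symmetric is closed under the swap
  `(a, b) ↦ (b, a)` followed by averaging (`symmetrise`), which makes `ψ` even in `t` with
  `ψ_t(0, ·) = 0` for free.

No definitions are introduced.
-/

noncomputable section

open Set Filter Topology Function

namespace Summit.FinalStateConjecture.FinalStateConjecture.Theorems.Blindness

/-- `iteratedDeriv 2` from two `HasDerivAt` layers. -/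
theorem iteratedDeriv_two_eq_of_hasDerivAt {f g : ℝ → ℝ} {d t₀ : ℝ}
    (hf : ∀ t, HasDerivAt f (g t) t) (hg : HasDerivAt g d t₀) : iteratedDeriv 2 f t₀ = d := by
  have h1 : deriv f = g := funext fun t => (hf t).deriv
  rw [iteratedDeriv_succ, iteratedDeriv_one, h1, hg.deriv]

section Transfer

variable {U P Q c : ℝ × ℝ → ℝ}

/-- The null-coordinate map `τ ↦ (x + τ, x − τ)` has velocity `(1, −1)`. -/
theorem hasDerivAt_nullMap_time (x t : ℝ) :
    HasDerivAt (fun τ : ℝ => (x + τ, x - τ)) ((1 : ℝ), (-1 : ℝ)) t := by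
  have h1 : HasDerivAt (fun τ : ℝ => x + τ) 1 t := by
    simpa using (hasDerivAt_id t).const_add x
  have h2 : HasDerivAt (fun τ : ℝ => x - τ) (-1) t := by
    simpa using (hasDerivAt_id t).const_sub x
  exact h1.prodMk h2

/-- The null-coordinate map `y ↦ (y + t, y − t)` has velocity `(1, 1)`. -/
theorem hasDerivAt_nullMap_space (t x : ℝ) :
    HasDerivAt (fun y : ℝ => (y + t, y - t)) ((1 : ℝ), (1 : ℝ)) x := by
  have h1 : HasDerivAt (fun y : ℝ => y + t) 1 x := by
    simpa using (hasDerivAt_id x).add_const t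
  have h2 : HasDerivAt (fun y : ℝ => y - t) 1 x := by
    simpa using (hasDerivAt_id x).sub_const t
  exact h1.prodMk h2

/-- `ψ(t,x) = U(x+t, x−t)` is `C²` if `U` is. -/
theorem contDiff_two_transfer (hU : ContDiff ℝ 2 U) :
    ContDiff ℝ 2 (uncurry fun t x : ℝ => U (x + t, x - t)) := by
  have hm : ContDiff ℝ 2 fun p : ℝ × ℝ => (p.2 + p.1, p.2 - p.1) :=
    (contDiff_snd.add contDiff_fst).prodMk (contDiff_snd.sub contDiff_fst)
  exact hU.comp hm

/-- Time lines: `∂_t ψ = (P − Q)(x+t, x−t)`. -/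
theorem hasDerivAt_transfer_time
    (hUd : ∀ p, HasFDerivAt U ((P p) • ContinuousLinearMap.fst ℝ ℝ ℝ +
      (Q p) • ContinuousLinearMap.snd ℝ ℝ ℝ) p) (t x : ℝ) :
    HasDerivAt (fun τ => U (x + τ, x - τ)) (P (x + t, x - t) - Q (x + t, x - t)) t := by
  have h := HasFDerivAt.comp_hasDerivAt (f := fun τ : ℝ => (x + τ, x - τ)) t
    (hUd (x + t, x - t)) (hasDerivAt_nullMap_time x t)
  refine (h.congr_of_eventuallyEq (Eventually.of_forall fun τ => rfl)).congr_deriv ?_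
  simp [sub_eq_add_neg]

/-- Space lines: `∂_x ψ = (P + Q)(x+t, x−t)`. -/
theorem hasDerivAt_transfer_space
    (hUd : ∀ p, HasFDerivAt U ((P p) • ContinuousLinearMap.fst ℝ ℝ ℝ +
      (Q p) • ContinuousLinearMap.snd ℝ ℝ ℝ) p) (t x : ℝ) :
    HasDerivAt (fun y => U (y + t, y - t)) (P (x + t, x - t) + Q (x + t, x - t)) x := by
  have h := HasFDerivAt.comp_hasDerivAt (f := fun y : ℝ => (y + t, y - t)) x
    (hUd (x + t, x - t)) (hasDerivAt_nullMap_space t x)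
  refine (h.congr_of_eventuallyEq (Eventually.of_forall fun τ => rfl)).congr_deriv ?_
  simp

/-- Second time derivative along time lines. -/
theorem hasDerivAt_transfer_time_two (hP : ContDiff ℝ 1 P) (hQ : ContDiff ℝ 1 Q) (t x : ℝ) :
    HasDerivAt (fun τ => P (x + τ, x - τ) - Q (x + τ, x - τ))
      (fderiv ℝ P (x + t, x - t) (1, -1) - fderiv ℝ Q (x + t, x - t) (1, -1)) t := by
  have hPd := (hP.differentiable one_ne_zero (x + t, x - t)).hasFDerivAt
  have hQd := (hQ.differentiable one_ne_zero (x + t, x - t)).hasFDerivAt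
  have h1 := HasFDerivAt.comp_hasDerivAt (f := fun τ : ℝ => (x + τ, x - τ)) t hPd
    (hasDerivAt_nullMap_time x t)
  have h2 := HasFDerivAt.comp_hasDerivAt (f := fun τ : ℝ => (x + τ, x - τ)) t hQd
    (hasDerivAt_nullMap_time x t)
  exact (h1.sub h2).congr_of_eventuallyEq (Eventually.of_forall fun τ => rfl)

/-- Second space derivative along space lines. -/
theorem hasDerivAt_transfer_space_two (hP : ContDiff ℝ 1 P) (hQ : ContDiff ℝ 1 Q) (t x : ℝ) :
    HasDerivAt (fun y => P (y + t, y - t) + Q (y + t, y - t))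
      (fderiv ℝ P (x + t, x - t) (1, 1) + fderiv ℝ Q (x + t, x - t) (1, 1)) x := by
  have hPd := (hP.differentiable one_ne_zero (x + t, x - t)).hasFDerivAt
  have hQd := (hQ.differentiable one_ne_zero (x + t, x - t)).hasFDerivAt
  have h1 := HasFDerivAt.comp_hasDerivAt (f := fun y : ℝ => (y + t, y - t)) x hPd
    (hasDerivAt_nullMap_space t x)
  have h2 := HasFDerivAt.comp_hasDerivAt (f := fun y : ℝ => (y + t, y - t)) x hQd
    (hasDerivAt_nullMap_space t x)
  exact (h1.add h2).congr_of_eventuallyEq (Eventually.of_forall fun τ => rfl)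

/-- The algebra of the chain rule: `(∂_a − ∂_b)(P − Q) − (∂_a + ∂_b)(P + Q) = −2∂_bP − 2∂_aQ`. -/
theorem second_derivatives_identity (hPb : ∀ p, fderiv ℝ P p (0, 1) = c p * U p)
    (hQa : ∀ p, fderiv ℝ Q p (1, 0) = c p * U p) (p : ℝ × ℝ) :
    (fderiv ℝ P p (1, -1) - fderiv ℝ Q p (1, -1)) - (fderiv ℝ P p (1, 1) + fderiv ℝ Q p (1, 1))
      = -4 * (c p * U p) := by
  have e1 : ((1 : ℝ), (-1 : ℝ)) - (1, 1) = (-2 : ℝ) • ((0 : ℝ), (1 : ℝ)) := by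
    ext <;> norm_num
  have e2 : ((1 : ℝ), (-1 : ℝ)) + (1, 1) = (2 : ℝ) • ((1 : ℝ), (0 : ℝ)) := by
    ext <;> norm_num
  have hP' : fderiv ℝ P p (1, -1) - fderiv ℝ P p (1, 1) = -2 * (c p * U p) := by
    rw [← map_sub, e1, map_smul, hPb p, smul_eq_mul]
  have hQ' : fderiv ℝ Q p (1, -1) + fderiv ℝ Q p (1, 1) = 2 * (c p * U p) := by
    rw [← map_add, e2, map_smul, hQa p, smul_eq_mul]
  linear_combination hP' - hQ'

/-- **The transferred equation**: for `ψ(t, x) = U(x+t, x−t)`,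
`ψ_tt − ψ_xx = −4 c(x+t, x−t) ψ` in the `iteratedDeriv` form of the route statement. -/
theorem iteratedDeriv_two_time_sub_space (hP : ContDiff ℝ 1 P) (hQ : ContDiff ℝ 1 Q)
    (hUd : ∀ p, HasFDerivAt U ((P p) • ContinuousLinearMap.fst ℝ ℝ ℝ +
      (Q p) • ContinuousLinearMap.snd ℝ ℝ ℝ) p)
    (hPb : ∀ p, fderiv ℝ P p (0, 1) = c p * U p)
    (hQa : ∀ p, fderiv ℝ Q p (1, 0) = c p * U p) (t x : ℝ) :
    iteratedDeriv 2 (fun τ => U (x + τ, x - τ)) t - iteratedDeriv 2 (fun y => U (y + t, y - t)) x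
      = -4 * (c (x + t, x - t) * U (x + t, x - t)) := by
  rw [iteratedDeriv_two_eq_of_hasDerivAt (fun τ => hasDerivAt_transfer_time hUd τ x)
      (hasDerivAt_transfer_time_two hP hQ t x),
    iteratedDeriv_two_eq_of_hasDerivAt (fun y => hasDerivAt_transfer_space hUd t y)
      (hasDerivAt_transfer_space_two hP hQ t x)]
  exact second_derivatives_identity hPb hQa _

end Transfer

/-! ### Symmetrisation under the swap `(a, b) ↦ (b, a)` -/

section Symmetrise

variable {U P Q c : ℝ × ℝ → ℝ}

/-- The swap as a continuous linear map and its derivative. -/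
theorem hasFDerivAt_swap' (p : ℝ × ℝ) :
    HasFDerivAt (fun q : ℝ × ℝ => (q.2, q.1))
      ((ContinuousLinearMap.snd ℝ ℝ ℝ).prod (ContinuousLinearMap.fst ℝ ℝ ℝ)) p :=
  hasFDerivAt_snd.prodMk hasFDerivAt_fst

/-- **Symmetrisation.** If `(U, P, Q)` is an admissible triple for a symmetric coefficient `c`,
so is its swap-average `U' = (U + U∘sw)/2`, `P' = (P + Q∘sw)/2`, `Q' = (Q + P∘sw)/2`. -/
theorem symmetrise (hU : ContDiff ℝ 2 U) (hP : ContDiff ℝ 1 P) (hQ : ContDiff ℝ 1 Q)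
    (hUd : ∀ p, HasFDerivAt U ((P p) • ContinuousLinearMap.fst ℝ ℝ ℝ +
      (Q p) • ContinuousLinearMap.snd ℝ ℝ ℝ) p)
    (hPb : ∀ p, fderiv ℝ P p (0, 1) = c p * U p)
    (hQa : ∀ p, fderiv ℝ Q p (1, 0) = c p * U p) (hcs : ∀ p : ℝ × ℝ, c (p.2, p.1) = c p) :
    ContDiff ℝ 2 (fun p : ℝ × ℝ => 2⁻¹ * (U p + U (p.2, p.1))) ∧
    ContDiff ℝ 1 (fun p : ℝ × ℝ => 2⁻¹ * (P p + Q (p.2, p.1))) ∧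
    ContDiff ℝ 1 (fun p : ℝ × ℝ => 2⁻¹ * (Q p + P (p.2, p.1))) ∧
    (∀ p, HasFDerivAt (fun p : ℝ × ℝ => 2⁻¹ * (U p + U (p.2, p.1)))
      ((2⁻¹ * (P p + Q (p.2, p.1))) • ContinuousLinearMap.fst ℝ ℝ ℝ +
        (2⁻¹ * (Q p + P (p.2, p.1))) • ContinuousLinearMap.snd ℝ ℝ ℝ) p) ∧
    (∀ p, fderiv ℝ (fun p : ℝ × ℝ => 2⁻¹ * (P p + Q (p.2, p.1))) p (0, 1)
      = c p * (2⁻¹ * (U p + U (p.2, p.1)))) ∧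
    (∀ p, fderiv ℝ (fun p : ℝ × ℝ => 2⁻¹ * (Q p + P (p.2, p.1))) p (1, 0)
      = c p * (2⁻¹ * (U p + U (p.2, p.1)))) := by
  have hsw : ContDiff ℝ 2 fun q : ℝ × ℝ => (q.2, q.1) := contDiff_snd.prodMk contDiff_fst
  have hsw1 : ContDiff ℝ 1 fun q : ℝ × ℝ => (q.2, q.1) := contDiff_snd.prodMk contDiff_fst
  set S : ℝ × ℝ →L[ℝ] ℝ × ℝ := (ContinuousLinearMap.snd ℝ ℝ ℝ).prod (ContinuousLinearMap.fst ℝ ℝ ℝ)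
    with hS
  -- derivatives of the swapped fields
  have hUsw : ∀ p : ℝ × ℝ, HasFDerivAt (fun q : ℝ × ℝ => U (q.2, q.1))
      ((P (p.2, p.1)) • ContinuousLinearMap.snd ℝ ℝ ℝ +
        (Q (p.2, p.1)) • ContinuousLinearMap.fst ℝ ℝ ℝ) p := by
    intro p
    have h := (hUd (p.2, p.1)).comp p (hasFDerivAt_swap' p)
    refine h.congr_fderiv ?_
    ext <;> simp
  have hPsw : ∀ p : ℝ × ℝ, HasFDerivAt (fun q : ℝ × ℝ => P (q.2, q.1))
      ((fderiv ℝ P (p.2, p.1)).comp S) p := fun p =>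
    ((hP.differentiable one_ne_zero (p.2, p.1)).hasFDerivAt).comp p (hasFDerivAt_swap' p)
  have hQsw : ∀ p : ℝ × ℝ, HasFDerivAt (fun q : ℝ × ℝ => Q (q.2, q.1))
      ((fderiv ℝ Q (p.2, p.1)).comp S) p := fun p =>
    ((hQ.differentiable one_ne_zero (p.2, p.1)).hasFDerivAt).comp p (hasFDerivAt_swap' p)
  refine ⟨?_, ?_, ?_, ?_, ?_, ?_⟩
  · exact contDiff_const.mul (hU.add (hU.comp hsw))
  · exact contDiff_const.mul (hP.add (hQ.comp hsw1))
  · exact contDiff_const.mul (hQ.add (hP.comp hsw1))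
  · intro p
    have h := ((hUd p).add (hUsw p)).const_mul (2⁻¹ : ℝ)
    refine h.congr_fderiv ?_
    ext <;> simp <;> ring
  · intro p
    have h : HasFDerivAt (fun p : ℝ × ℝ => 2⁻¹ * (P p + Q (p.2, p.1)))
        ((2⁻¹ : ℝ) • (fderiv ℝ P p + (fderiv ℝ Q (p.2, p.1)).comp S)) p :=
      ((((hP.differentiable one_ne_zero p).hasFDerivAt).add (hQsw p)).const_mul
        (2⁻¹ : ℝ)).congr_of_eventuallyEq (Eventually.of_forall fun q => rfl)
    rw [h.fderiv]
    simp only [smul_apply, add_apply,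
      ContinuousLinearMap.comp_apply, hS, ContinuousLinearMap.prod_apply,
      ContinuousLinearMap.coe_snd', ContinuousLinearMap.coe_fst', smul_eq_mul]
    rw [hPb p, hQa (p.2, p.1), hcs p]
    ring
  · intro p
    have h : HasFDerivAt (fun p : ℝ × ℝ => 2⁻¹ * (Q p + P (p.2, p.1)))
        ((2⁻¹ : ℝ) • (fderiv ℝ Q p + (fderiv ℝ P (p.2, p.1)).comp S)) p :=
      ((((hQ.differentiable one_ne_zero p).hasFDerivAt).add (hPsw p)).const_mul
        (2⁻¹ : ℝ)).congr_of_eventuallyEq (Eventually.of_forall fun q => rfl)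
    rw [h.fderiv]
    simp only [smul_apply, add_apply,
      ContinuousLinearMap.comp_apply, hS, ContinuousLinearMap.prod_apply,
      ContinuousLinearMap.coe_snd', ContinuousLinearMap.coe_fst', smul_eq_mul]
    rw [hQa p, hPb (p.2, p.1), hcs p]
    ring

end Symmetrise

end Summit.FinalStateConjecture.FinalStateConjecture.Theorems.Blindness

end
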